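import Literature.MathematicalPhysics.QuantumLattice.HubbardTorus2DEnergyDensity
import Summits.HubbardSuperconductivity.HubbardSuperconductivity.Theorems.WeakCouplingBCSWcbcsBcsConstructionGcGroundEnergyEqMin
import HarnessLib

/-!
# Route `ThermalWedge`, item `stmt-HubbardSuperconductivity-1702` (`TwPureThermalBound`):
# supporting lines of the sector energies of the Hubbard torus (master bounds for GSEE)

Support file 1/3 of the proof of `TwPureThermalBound` via the thermodynamic limit
(`--supports stmt-HubbardSuperconductivity-1702`; no definition). With `e = energyDensity2D 1 U`
(the limiting ground-state energy density of the `L × L` Hubbard torus, `Literature/…/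
HubbardTorus2DEnergyDensity.lean`) and a subgradient `s` of `e` at a density `n₀`:

* `exists_subgradient_of_convexOn_Ico` — subgradients of a convex function of one real variable
  exist at interior points (supremum of the left secant slopes);
* `master_ub` — eventually `E_{torus L}(N_L(n₀)) ≤ L² e(n₀) + ηL²` (pointwise convergence);
* `master_lb` — eventually, for ALL `N ≤ 2L²`, `L² e(n₀) + s (N - n₀L²) - ηL² ≤ E_{torus L}(N)` (the
  tiling lower bound `energyDensity2D_le` at even `0 < N < 2L²`, one or two one-particle steps
  `torusCost_succ/pred` — the tree's `groundEnergyAt_succ_le/pred_le` at degree `4` — elsewhere);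
* `gc_eq_iInf`, `exists_gcSector`, `gc_le_sector` — the grand-canonical ground energy of the torus
  as the minimum over sectors (the tree's `stub_gcGroundEnergyEqMin`).

(Ruelle, *Statistical Mechanics* (1969), §3.4.) [cite: Ruelle1969, §3.4]
-/

set_option linter.dupNamespace false

noncomputable section

namespace Summit.HubbardSuperconductivity.HubbardSuperconductivity.Theorems.TwPureThermalBoundGsee

open Matrix Finset Filter Topology
open Literature.MathematicalPhysics.QuantumLattice Literature.MathematicalPhysics.QuantumLattice.ThermodynamicLimit
open scoped BigOperators

/-- **Subgradients of a convex function of one variable exist at interior points**: for `f` convex on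
`[a, b)` and `a < x₀ < b` there is `s` with `f x₀ + s (y - x₀) ≤ f y` on `[a, b)` (take the supremum
of the left secant slopes, `ConvexOn.secant_mono`). [folklore] -/
theorem exists_subgradient_of_convexOn_Ico {f : ℝ → ℝ} {a b x₀ : ℝ} (hf : ConvexOn ℝ (Set.Ico a b) f)
    (hx₀ : x₀ ∈ Set.Ioo a b) : ∃ s : ℝ, ∀ y ∈ Set.Ico a b, f x₀ + s * (y - x₀) ≤ f y := by
  obtain ⟨hax, hxb⟩ := hx₀
  have hx₀m : x₀ ∈ Set.Ico a b := ⟨hax.le, hxb⟩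
  set y₁ : ℝ := (x₀ + b) / 2 with hy₁
  have hy₁m : y₁ ∈ Set.Ico a b := ⟨by simp only [hy₁]; linarith, by simp only [hy₁]; linarith⟩
  have hxy₁ : x₀ < y₁ := by simp only [hy₁]; linarith
  -- left secant slopes
  set S : Set ℝ := (fun z => (f z - f x₀) / (z - x₀)) '' Set.Ico a x₀ with hS
  have hSne : S.Nonempty := ⟨_, a, ⟨le_rfl, hax⟩, rfl⟩
  have hSle : ∀ y, x₀ < y → y < b → ∀ q ∈ S, q ≤ (f y - f x₀) / (y - x₀) := by
    rintro y hy hyb _ ⟨z, ⟨haz, hzx⟩, rfl⟩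
    exact hf.secant_mono hx₀m ⟨haz, hzx.trans hxb⟩ ⟨hax.le.trans hy.le, hyb⟩
      hzx.ne hy.ne' (hzx.le.trans hy.le)
  have hSbdd : BddAbove S := ⟨_, hSle y₁ hxy₁ hy₁m.2⟩
  refine ⟨sSup S, fun y hy => ?_⟩
  rcases lt_trichotomy y x₀ with h | rfl | h
  · -- `y < x₀`: the slope through `y` is in `S`
    have hmem : (f y - f x₀) / (y - x₀) ∈ S := ⟨y, ⟨hy.1, h⟩, rfl⟩
    have h1 := le_csSup hSbdd hmem
    have hneg : y - x₀ < 0 := by linarith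
    rw [div_eq_mul_inv] at h1
    have : f y - f x₀ ≥ sSup S * (y - x₀) := by
      have h2 := mul_le_mul_of_nonpos_right h1 hneg.le
      rwa [mul_assoc, inv_mul_cancel₀ hneg.ne, mul_one] at h2
    linarith
  · simp
  · -- `x₀ < y`
    have h1 : sSup S ≤ (f y - f x₀) / (y - x₀) := csSup_le hSne (hSle y h hy.2)
    have hpos : 0 < y - x₀ := by linarith
    rw [le_div_iff₀ hpos] at h1
    linarith

section Torus

open Literature.Probability.LatticeModels

/-- The one-particle cost constant of the square torus at hopping `1`: `K(U) = 18(2 + |U|)`.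
[folklore] -/
theorem torusCost_succ (L : ℕ) [NeZero L] (U : ℝ) {N : ℕ} (hN : N < 2 * (L * L)) :
    groundEnergyAt (fermionTorusGraph 2 L) 1 U (N + 1) ≤ groundEnergyAt (fermionTorusGraph 2 L) 1 U N +
      18 * (2 + |U|) * (2 * (L * L : ℕ)) / (2 * (L * L : ℕ) - N) := by
  have hc : Fintype.card (FermionTorus 2 L) = L * L := by simp [FermionTorus, Fintype.card_lex, sq]
  have h := groundEnergyAt_succ_le (fermionTorusGraph 2 L) (Δ := 4)
    (fun x => SourceGas.card_filter_fermionTorusGraph_adj_le x) 1 U (N := N) (by rw [hc]; exact hN)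
  rw [hc] at h
  refine h.trans (le_of_eq ?_)
  norm_num
  ring

/-- The removal cost on the square torus at hopping `1`. [folklore] -/
theorem torusCost_pred (L : ℕ) [NeZero L] (U : ℝ) {N : ℕ} (hN1 : 1 ≤ N) (hN : N ≤ 2 * (L * L)) :
    groundEnergyAt (fermionTorusGraph 2 L) 1 U (N - 1) ≤ groundEnergyAt (fermionTorusGraph 2 L) 1 U N +
      18 * (2 + |U|) * (2 * (L * L : ℕ)) / N := by
  have hc : Fintype.card (FermionTorus 2 L) = L * L := by simp [FermionTorus, Fintype.card_lex, sq]
  have h := groundEnergyAt_pred_le (fermionTorusGraph 2 L) (Δ := 4)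
    (fun x => SourceGas.card_filter_fermionTorusGraph_adj_le x) 1 U hN1 (by rw [hc]; exact hN)
  rw [hc] at h
  refine h.trans (le_of_eq ?_)
  norm_num
  ring


/-- `|Fin L²|`: `card (FermionTorus 2 L) = L·L`. -/
theorem card_fermionTorus_two' (L : ℕ) : Fintype.card (FermionTorus 2 L) = L * L := by
  simp [FermionTorus, Fintype.card_lex, sq]

/-- **Master upper bound.** Pointwise convergence at density `n₀`:
eventually `E_{torus L}(N_L(n₀)) ≤ L² e(n₀) + η L²`. [cite: Ruelle1969, §3.3] -/
theorem master_ub {U : ℝ} (hU : 0 ≤ U) {n₀ : ℝ} (hn0 : 0 ≤ n₀) (hn2 : n₀ < 2) {η : ℝ} (hη : 0 < η) :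
    ∃ L₀ : ℕ, ∀ L : ℕ, L₀ ≤ L →
      groundEnergyAt (fermionTorusGraph 2 L) 1 U (rectN n₀ L) ≤
        (L : ℝ) ^ 2 * energyDensity2D 1 U n₀ + η * (L : ℝ) ^ 2 := by
  have h := (tendsto_energyDensity2D_torus 1 hU hn0 hn2)
  have h2 := (Metric.tendsto_atTop.1 h) η hη
  obtain ⟨L₀, hL₀⟩ := h2
  refine ⟨max L₀ 1, fun L hL => ?_⟩
  have h3 := hL₀ L (le_of_max_le_left hL)
  have hL1 : (1 : ℝ) ≤ L := by exact_mod_cast le_of_max_le_right hL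
  have hL2 : (0 : ℝ) < (L : ℝ) ^ 2 := by positivity
  rw [Real.dist_eq, abs_sub_lt_iff] at h3
  have h4 := h3.1
  rw [sub_lt_iff_lt_add, div_lt_iff₀ hL2] at h4
  linarith

/-- **Master lower bound.** If `s` is a subgradient at `n₀ ∈ (0, 2)` of the (convex) energy density
`e = energyDensity2D 1 U` on `[0, 2)`, then for every `η > 0`, eventually in `L`, ALL sector energies
of the `L × L` Hubbard torus lie above the supporting line up to `ηL²`:
`L² e(n₀) + s (N - n₀ L²) - η L² ≤ E_{torus L}(N)` for every `N ≤ 2L²` (tiling lower bound at even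
`0 < N < 2L²`; odd and extreme `N` by one or two one-particle steps). [cite: Ruelle1969, §3.4] -/
theorem master_lb {U : ℝ} (hU : 0 ≤ U) {n₀ : ℝ} {s : ℝ}
    (hs : ∀ y ∈ Set.Ico (0 : ℝ) 2, energyDensity2D 1 U n₀ + s * (y - n₀) ≤ energyDensity2D 1 U y)
    {η : ℝ} (hη : 0 < η) :
    ∃ L₀ : ℕ, ∀ L : ℕ, L₀ ≤ L → ∀ N : ℕ, N ≤ 2 * (L * L) →
      (L : ℝ) ^ 2 * energyDensity2D 1 U n₀ + s * (N - n₀ * (L : ℝ) ^ 2) - η * (L : ℝ) ^ 2 ≤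
        groundEnergyAt (fermionTorusGraph 2 L) 1 U N := by
  set K : ℝ := 18 * (2 + |U|) with hK
  have hK0 : 0 ≤ K := by positivity
  set C : ℝ := 16 + 4 * K + 4 * |s| with hC
  have hC0 : 0 < C := by positivity
  obtain ⟨L₁, hL₁⟩ := exists_nat_gt (C / η)
  refine ⟨max L₁ 2, fun L hL N hN => ?_⟩
  have hL2 : 2 ≤ L := le_of_max_le_right hL
  haveI : NeZero L := ⟨by omega⟩
  have hLr : (2 : ℝ) ≤ L := by exact_mod_cast hL2
  have hLpos : (0 : ℝ) < L := by linarith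
  have hslack : 16 * (L : ℝ) + 4 * K + 4 * |s| ≤ η * (L : ℝ) ^ 2 := by
    have h1 : C / η < L := hL₁.trans_le (by exact_mod_cast le_of_max_le_left hL)
    rw [div_lt_iff₀ hη] at h1
    have hL1 : (1 : ℝ) ≤ L := by linarith
    have : 16 * (L : ℝ) + 4 * K + 4 * |s| ≤ C * L := by
      have h4 : (4 * K + 4 * |s|) * 1 ≤ (4 * K + 4 * |s|) * L :=
        mul_le_mul_of_nonneg_left hL1 (by positivity)
      simp only [hC]; linarith
    nlinarith
  have hs0 : 0 ≤ |s| := abs_nonneg s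
  have hLL4 : 4 ≤ L * L := Nat.mul_le_mul hL2 hL2
  set e := energyDensity2D 1 U with he
  set E : ℕ → ℝ := fun N => groundEnergyAt (fermionTorusGraph 2 L) 1 U N with hE
  -- the core bound at even interior particle numbers
  have core : ∀ m : ℕ, 0 < m → m < L * L →
      (L : ℝ) ^ 2 * e n₀ + s * ((2 * m : ℕ) - n₀ * (L : ℝ) ^ 2) - 16 * L ≤ E (2 * m) := by
    intro m hm0 hm
    have hL1 : 1 ≤ L := by omega
    have h1 := energyDensity2D_le 1 hU hL1 hm
    rw [← groundEnergyAt_fermionTorusGraph_two] at h1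
    have hy : ((2 * m : ℕ) : ℝ) / (L : ℝ) ^ 2 ∈ Set.Ico (0 : ℝ) 2 := by
      constructor
      · positivity
      · rw [div_lt_iff₀ (by positivity)]
        have : ((2 * m : ℕ) : ℝ) < 2 * (L * L : ℕ) := by exact_mod_cast (by omega : 2 * m < 2 * (L * L))
        push_cast at this ⊢; nlinarith
    have h2 := hs _ hy
    simp only [abs_one, mul_one] at h1
    have hL2' : (0 : ℝ) < (L : ℝ) ^ 2 := by positivity
    -- `e(2m/L²) ≤ E(2m)/L² + 16/L`, `e n₀ + s (2m/L² - n₀) ≤ e(2m/L²)`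
    have h3 : (L : ℝ) ^ 2 * e (((2 * m : ℕ) : ℝ) / (L : ℝ) ^ 2) ≤ E (2 * m) + 16 * L := by
      have := mul_le_mul_of_nonneg_left h1 hL2'.le
      have e1 : (L : ℝ) ^ 2 * (groundEnergyAt (fermionTorusGraph 2 L) 1 U (2 * m) / (L : ℝ) ^ 2 + 16 / L) =
          groundEnergyAt (fermionTorusGraph 2 L) 1 U (2 * m) + 16 * L := by
        field_simp
      rw [e1] at this; exact this
    have h4 : (L : ℝ) ^ 2 * (e n₀ + s * (((2 * m : ℕ) : ℝ) / (L : ℝ) ^ 2 - n₀)) =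
        (L : ℝ) ^ 2 * e n₀ + s * ((2 * m : ℕ) - n₀ * (L : ℝ) ^ 2) := by
      field_simp
    have h5 := mul_le_mul_of_nonneg_left h2 hL2'.le
    rw [h4] at h5
    linarith
  -- one-particle steps
  have hLL : (((L * L : ℕ) : ℝ)) = (L : ℝ) ^ 2 := by push_cast; ring
  have stepUp : ∀ M : ℕ, M < L * L → E M ≥ E (M + 1) - 2 * K := by
    intro M hM
    have h := torusCost_succ L U (N := M) (by omega)
    have hden : (L : ℝ) ^ 2 ≤ 2 * ((L * L : ℕ) : ℝ) - M := by
      have : (M : ℝ) < (L * L : ℕ) := by exact_mod_cast hM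
      rw [hLL] at this ⊢; linarith
    have hfrac : 18 * (2 + |U|) * (2 * ((L * L : ℕ) : ℝ)) / (2 * ((L * L : ℕ) : ℝ) - M) ≤ 2 * K := by
      rw [div_le_iff₀ (by nlinarith), hK, hLL]
      rw [hLL] at hden
      nlinarith
    show E (M + 1) - 2 * K ≤ E M
    simp only [hE]; linarith
  have stepDown : ∀ M : ℕ, L * L ≤ M → M ≤ 2 * (L * L) → E M ≥ E (M - 1) - 2 * K := by
    intro M hM hM2
    have h := torusCost_pred L U (N := M) (by nlinarith) hM2
    have hMr : (L : ℝ) ^ 2 ≤ M := by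
      have : ((L * L : ℕ) : ℝ) ≤ M := by exact_mod_cast hM
      rwa [hLL] at this
    have hMpos : (0 : ℝ) < M := by nlinarith
    have hfrac : 18 * (2 + |U|) * (2 * ((L * L : ℕ) : ℝ)) / M ≤ 2 * K := by
      rw [div_le_iff₀ hMpos, hK, hLL]
      nlinarith
    show E (M - 1) - 2 * K ≤ E M
    simp only [hE]; linarith
  -- case analysis on `N`
  have target : ∀ M : ℕ, (∃ m, 0 < m ∧ m < L * L ∧ M = 2 * m) → ((M : ℝ) - N ≤ 2 ∧ (N : ℝ) - M ≤ 2) →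
      E N ≥ E M - 4 * K →
      (L : ℝ) ^ 2 * e n₀ + s * (N - n₀ * (L : ℝ) ^ 2) - η * (L : ℝ) ^ 2 ≤ E N := by
    rintro M ⟨m, hm0, hm, rfl⟩ ⟨hd1, hd2⟩ hEN
    have hc := core m hm0 hm
    have hsd : s * ((N : ℝ) - n₀ * (L : ℝ) ^ 2) ≤ s * (((2 * m : ℕ) : ℝ) - n₀ * (L : ℝ) ^ 2) + 2 * |s| := by
      have : s * ((N : ℝ) - n₀ * (L : ℝ) ^ 2) - s * (((2 * m : ℕ) : ℝ) - n₀ * (L : ℝ) ^ 2) =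
          s * ((N : ℝ) - (2 * m : ℕ)) := by ring
      have h2 : s * ((N : ℝ) - (2 * m : ℕ)) ≤ |s| * 2 := by
        calc s * ((N : ℝ) - (2 * m : ℕ)) ≤ |s * ((N : ℝ) - (2 * m : ℕ))| := le_abs_self _
          _ = |s| * |(N : ℝ) - (2 * m : ℕ)| := abs_mul _ _
          _ ≤ |s| * 2 := mul_le_mul_of_nonneg_left (abs_le.2 ⟨by linarith, by linarith⟩) (abs_nonneg s)
      linarith
    linarith
  rcases Nat.even_or_odd N with ⟨m, hm⟩ | ⟨m, hm⟩
  · -- `N = m + m` even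
    rcases Nat.eq_zero_or_pos m with h0 | hpos
    · -- `N = 0`: two steps up to `2`
      subst h0
      simp only [add_zero] at hm
      subst hm
      have hLL1 : 1 < L * L := by nlinarith
      refine target 2 ⟨1, one_pos, hLL1, rfl⟩ ⟨by norm_num, by norm_num⟩ ?_
      have h1 := stepUp 0 (by omega)
      have h2 := stepUp 1 hLL1
      norm_num at h1 h2 ⊢
      linarith
    · rcases lt_or_ge m (L * L) with hm2 | hm2
      · -- interior even
        refine target N ⟨m, hpos, hm2, by omega⟩ ⟨by norm_num, by norm_num⟩ (by linarith)
      · -- `N = 2L²`: two steps down to `2L² - 2`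
        have hN2 : N = 2 * (L * L) := by omega
        have hLL1 : 1 < L * L := by nlinarith
        refine target (2 * (L * L - 1)) ⟨L * L - 1, by omega, by omega, rfl⟩
          ⟨by rw [hN2]; push_cast [Nat.cast_sub hLL1.le]; nlinarith, by
            rw [hN2]; push_cast [Nat.cast_sub hLL1.le]; nlinarith⟩ ?_
        have h1 := stepDown (2 * (L * L)) (by omega) le_rfl
        have h2 := stepDown (2 * (L * L) - 1) (by omega) (by omega)
        rw [show 2 * (L * L) - 1 - 1 = 2 * (L * L - 1) by omega] at h2
        rw [hN2]
        linarith
  · -- `N = 2m + 1` odd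
    rcases lt_or_ge N (L * L) with hN1 | hN1
    · -- step up
      refine target (N + 1) ⟨m + 1, by omega, by omega, by omega⟩ ⟨by push_cast; linarith, by
        push_cast; linarith⟩ ?_
      have h1 := stepUp N hN1
      linarith
    · -- step down
      refine target (N - 1) ⟨m, by omega, by omega, by omega⟩
        ⟨by rw [Nat.cast_sub (by omega)]; push_cast; linarith, by rw [Nat.cast_sub (by omega)]; push_cast; linarith⟩ ?_
      have h1 := stepDown N hN1 hN
      linarith


/-- The grand-canonical ground energy of the torus as a minimum over the particle-number sectors
(tree `stub_gcGroundEnergyEqMin`; `convert` absorbs the syntactically different `DecidableEq`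
instance of the concrete torus). [folklore] -/
theorem gc_eq_iInf (L : ℕ) (U μ : ℝ) :
    (hubbardTorusWith 2 L 1 U μ).groundEnergy =
      ⨅ N : Fin (2 * Fintype.card (FermionTorus 2 L) + 1),
        (groundEnergyAt (fermionTorusGraph 2 L) 1 U (N : ℕ) - μ * ((N : ℕ) : ℝ)) := by
  unfold hubbardTorusWith
  convert Summit.HubbardSuperconductivity.HubbardSuperconductivity.Theorems.stub_gcGroundEnergyEqMin
    (fermionTorusGraph 2 L) 1 U μ using 2

/-- **A grand-canonical ground sector exists**: `E₀(H − μN) = E(N°) − μN°` for some `N° ≤ 2L²`.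
[folklore] -/
theorem exists_gcSector (L : ℕ) (U μ : ℝ) :
    ∃ N : ℕ, N ≤ 2 * (L * L) ∧ (hubbardTorusWith 2 L 1 U μ).groundEnergy =
      groundEnergyAt (fermionTorusGraph 2 L) 1 U N - μ * N := by
  obtain ⟨i, hi⟩ := exists_eq_ciInf_of_finite
    (f := fun N : Fin (2 * Fintype.card (FermionTorus 2 L) + 1) =>
      groundEnergyAt (fermionTorusGraph 2 L) 1 U (N : ℕ) - μ * ((N : ℕ) : ℝ))
  refine ⟨i, ?_, ?_⟩
  · have h1 := i.isLt
    have h2 := card_fermionTorus_two' L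
    omega
  · rw [gc_eq_iInf, ← hi]

/-- The grand-canonical ground energy is below every sector: `E₀(H − μN) ≤ E(N) − μN`, `N ≤ 2L²`.
[folklore] -/
theorem gc_le_sector (L : ℕ) (U μ : ℝ) {N : ℕ} (hN : N ≤ 2 * (L * L)) :
    (hubbardTorusWith 2 L 1 U μ).groundEnergy ≤ groundEnergyAt (fermionTorusGraph 2 L) 1 U N - μ * N := by
  rw [gc_eq_iInf]
  have h2 := card_fermionTorus_two' L
  exact ciInf_le (Finite.bddBelow_range _) (⟨N, by omega⟩ : Fin (2 * Fintype.card (FermionTorus 2 L) + 1))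


end Torus

end Summit.HubbardSuperconductivity.HubbardSuperconductivity.Theorems.TwPureThermalBoundGsee
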